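import Summits.QuantumFields.YangMills.Theorems.LuscherReductionTwistedTraceScalingMagneticQuadratic
import Summits.QuantumFields.YangMills.Theorems.LuscherReductionTwistedTraceScalingTangentChart
import Summits.QuantumFields.YangMills.Theorems.LuscherReductionTwistedTraceScalingStiffHessian
import HarnessLib

/-!
# Near the vacuum the Wilson action of the `L³` torus IS the stiff-Hessian quadratic form up to `O(r³)`:
# `|S(U) − ‖d v(U)‖²| ≤ 644·|P|·r³` whenever every link satisfies `‖U_e − 1‖_F ≤ r ≤ 1`
# (capstone of the near-vacuum algebra of lane B; S-BASE of crux `TwistedTraceScaling` stmt-QuantumFields-20203; both COARSE lanes)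

Chain: `…MagneticQuadratic` (plaquette cost = `½‖(dF)_p‖_F²` + cubic, Frobenius-linear `F_e = U_e − 1`), `…TangentChart`
(`½‖(dF)_p‖_F² = |(dv)_p|² +` quartic, colour vectors `v_e = vecPart U_e`), `…StiffHessian` (`‖d v‖² = Σ_p |(dv)_p|² = ⟪v, Hv⟫`, `H = d†d`).
Here: `linkVec U ∈ LinkSpace L` (the colour-vector coordinates of a configuration), `wilsonAction_su2_eq_sum` (the action as the sum of plaquette
costs `2 − Re tr U_p`), the per-plaquette estimate `abs_plaquetteTerm_sub_curlVec_sq_le`, and ★ `abs_wilsonAction_sub_stiff_le`: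
for `‖U_e − 1‖_F ≤ r ≤ 1` on every link, `|S(U) − ‖latCurl L (linkVec U)‖²| ≤ 644·|P|·r³` (`|P| = 3L³` plaquettes).  With `r = β^{−1/2+δ}`
this is the `o(1)`-in-the-exponent control `β·|S − ⟪v,Hv⟫| ≤ 644|P|β^{3δ−1/2}` of the magnetic factor on the Gaussian bulk.
HONEST FRAMING: algebra + bookkeeping; no measure; femto rung R2b1 (stub of a child of a CONDITIONAL route); not a gap, not Clay.
-/

set_option autoImplicit false

noncomputable section

open scoped Matrix ComplexConjugate BigOperators RealInnerProductSpace
open Literature.MathematicalPhysics.QuantumFieldTheory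
open Literature.MathematicalPhysics.QuantumLattice

namespace Summit.QuantumFields.YangMills.Theorems.FemtoTransferGap.TwoLattice.Stiff

open Summit.QuantumFields.YangMills.Theorems.FemtoTransferGap
open Summit.QuantumFields.YangMills.Theorems.FemtoTransferGap.TwoLattice

variable {L : ℕ} [NeZero L]

/-! ## §1 The colour-vector coordinates of a configuration -/

variable (L) in
/-- The colour-vector (tangent-chart) coordinates of a configuration: `(linkVec U)(e; a) = vecPart(U_e)_a`. [cite: Luscher1983, §3] -/
def linkVec (U : GaugeConfig 3 L SU2) : LinkSpace L := WithLp.toLp 2 fun ea : Edge 3 L × Fin 3 => vecPart (U ea.1) ea.2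

omit [NeZero L] in
/-- Components of `linkVec`. [folklore] -/
@[simp] theorem linkVec_apply (U : GaugeConfig 3 L SU2) (e : Edge 3 L) (a : Fin 3) : linkVec L U (e, a) = vecPart (U e) a := rfl

/-- `‖d(linkVec U)‖² = Σ_{x, i<j} Σ_a (v(x,i) + v(x+eᵢ,j) − v(x+eⱼ,i) − v(x,j))_a²`. [folklore] -/
theorem norm_latCurl_linkVec_sq (U : GaugeConfig 3 L SU2) :
    ‖latCurl L (linkVec L U)‖ ^ 2 = ∑ p : Plaquette 3 L, ∑ a : Fin 3,
      (vecPart (U (p.1, p.2.1.1)) a + vecPart (U (p.1.shift p.2.1.1, p.2.1.2)) a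
        - vecPart (U (p.1.shift p.2.1.2, p.2.1.1)) a - vecPart (U (p.1, p.2.1.2)) a) ^ 2 := by
  rw [norm_latCurl_sq, Fintype.sum_prod_type]
  refine Finset.sum_congr rfl fun p _ => Finset.sum_congr rfl fun a _ => ?_
  rw [show p = (p.1, p.2) from rfl, latCurl_apply]
  simp only [linkVec_apply]

/-! ## §2 The Wilson action as a sum of plaquette costs; the per-plaquette estimate in the chart -/

/-- `S(U) = Σ_p (2 − Re tr U_p)` for the fundamental representation of `SU(2)`. [cite: Wilson1974] -/
theorem wilsonAction_su2_eq_sum (U : GaugeConfig 3 L SU2) :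
    wilsonAction su2Rep U = ∑ p : Plaquette 3 L, (2 - ((su2Rep (plaquetteHolonomy U p.1 p.2.1.1 p.2.1.2)).trace).re) := by
  unfold wilsonAction
  exact Finset.sum_congr rfl fun p _ => by norm_num

omit [NeZero L] in
/-- **Per plaquette, in the chart**: if the four links satisfy `‖U_e − 1‖_F ≤ r ≤ 1`, then
`|(2 − Re tr U_p) − Σ_a ((dv)_p)_a²| ≤ 644 r³`. [cite: Luscher1983, §3] [cite: MontvayMunster1994, §3.2.3] -/
theorem abs_plaquetteTerm_sub_curlVec_sq_le (U : GaugeConfig 3 L SU2) (x : Site 3 L) (i j : Fin 3) {r : ℝ} (hr1 : r ≤ 1)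
    (hr : ∀ e, frobNorm ((U e : Matrix (Fin 2) (Fin 2) ℂ) - 1) ≤ r) :
    |(2 - ((su2Rep (plaquetteHolonomy U x i j)).trace).re) -
        ∑ a : Fin 3, (vecPart (U (x, i)) a + vecPart (U (x.shift i, j)) a - vecPart (U (x.shift j, i)) a - vecPart (U (x, j)) a) ^ 2| ≤
      644 * r ^ 3 := by
  have hr0 : 0 ≤ r := (frobNorm_nonneg _).trans (hr (x, i))
  -- hemisphere: `‖U_e − 1‖² ≤ r² ≤ 4`
  have hs : ∀ e, 0 ≤ scalarPart (U e) := fun e => by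
    rw [scalarPart_nonneg_iff]
    have h := hr e
    have h0 := frobNorm_nonneg ((U e : Matrix (Fin 2) (Fin 2) ℂ) - 1)
    nlinarith
  -- `|v_e|² ≤ ‖F_e‖²/2 ≤ r²/2`
  have hv : ∀ e, ∑ a, vecPart (U e) a ^ 2 ≤ r ^ 2 / 2 := fun e => by
    have h1 := sum_vecPart_sq_le_frobNorm_sub_one_sq (U e)
    have h2 : frobNorm ((U e : Matrix (Fin 2) (Fin 2) ℂ) - 1) ^ 2 ≤ r ^ 2 := pow_le_pow_left₀ (frobNorm_nonneg _) (hr e) 2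
    linarith
  have hA := Magnetic.abs_plaquetteTerm_sub_curl_sq_le U x i j
  have hB := Chart.abs_half_frobNorm_curl_sq_sub_le (U (x, i)) (U (x.shift i, j)) (U (x.shift j, i)) (U (x, j))
    (hs _) (hs _) (hs _) (hs _)
  -- the two remainders
  set s : ℝ := frobNorm ((U (x, i) : Matrix (Fin 2) (Fin 2) ℂ) - 1) + frobNorm ((U (x.shift i, j) : Matrix (Fin 2) (Fin 2) ℂ) - 1)
    + frobNorm ((U (x.shift j, i) : Matrix (Fin 2) (Fin 2) ℂ) - 1) + frobNorm ((U (x, j) : Matrix (Fin 2) (Fin 2) ℂ) - 1) with hsdef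
  have hs0 : 0 ≤ s := by
    rw [hsdef]
    have := frobNorm_nonneg ((U (x, i) : Matrix (Fin 2) (Fin 2) ℂ) - 1)
    have := frobNorm_nonneg ((U (x.shift i, j) : Matrix (Fin 2) (Fin 2) ℂ) - 1)
    have := frobNorm_nonneg ((U (x.shift j, i) : Matrix (Fin 2) (Fin 2) ℂ) - 1)
    have := frobNorm_nonneg ((U (x, j) : Matrix (Fin 2) (Fin 2) ℂ) - 1)
    linarith
  have hs4 : s ≤ 4 * r := by
    have := hr (x, i); have := hr (x.shift i, j); have := hr (x.shift j, i); have := hr (x, j); linarith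
  have hR1 : 6 * s ^ 3 + s ^ 4 ≤ 640 * r ^ 3 := by
    have h3 : s ^ 3 ≤ (4 * r) ^ 3 := pow_le_pow_left₀ hs0 hs4 3
    have h4 : s ^ 4 ≤ (4 * r) ^ 4 := pow_le_pow_left₀ hs0 hs4 4
    have h5 : r ^ 4 ≤ r ^ 3 := by
      calc r ^ 4 = r ^ 3 * r := by ring
        _ ≤ r ^ 3 * 1 := mul_le_mul_of_nonneg_left hr1 (by positivity)
        _ = r ^ 3 := mul_one _
    nlinarith
  set q : ℝ := (∑ a, vecPart (U (x, i)) a ^ 2) + (∑ a, vecPart (U (x.shift i, j)) a ^ 2) + (∑ a, vecPart (U (x.shift j, i)) a ^ 2)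
    + ∑ a, vecPart (U (x, j)) a ^ 2 with hqdef
  have hq0 : 0 ≤ q := by
    rw [hqdef]
    have h1 : ∀ W : SU2, 0 ≤ ∑ a, vecPart W a ^ 2 := fun W => Finset.sum_nonneg fun a _ => sq_nonneg _
    linarith [h1 (U (x, i)), h1 (U (x.shift i, j)), h1 (U (x.shift j, i)), h1 (U (x, j))]
  have hq2 : q ≤ 2 * r ^ 2 := by
    have := hv (x, i); have := hv (x.shift i, j); have := hv (x.shift j, i); have := hv (x, j); linarith
  have hR2 : q ^ 2 ≤ 4 * r ^ 3 := by
    have h1 : q ^ 2 ≤ (2 * r ^ 2) ^ 2 := pow_le_pow_left₀ hq0 hq2 2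
    have h2 : r ^ 4 ≤ r ^ 3 := by
      calc r ^ 4 = r ^ 3 * r := by ring
        _ ≤ r ^ 3 * 1 := mul_le_mul_of_nonneg_left hr1 (by positivity)
        _ = r ^ 3 := mul_one _
    nlinarith
  -- triangle inequality
  have h := abs_sub_le (2 - ((su2Rep (plaquetteHolonomy U x i j)).trace).re)
    (frobNorm (((U (x, i) : Matrix (Fin 2) (Fin 2) ℂ) - 1) + ((U (x.shift i, j) : Matrix (Fin 2) (Fin 2) ℂ) - 1)
      - ((U (x.shift j, i) : Matrix (Fin 2) (Fin 2) ℂ) - 1) - ((U (x, j) : Matrix (Fin 2) (Fin 2) ℂ) - 1)) ^ 2 / 2)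
    (∑ a : Fin 3, (vecPart (U (x, i)) a + vecPart (U (x.shift i, j)) a - vecPart (U (x.shift j, i)) a - vecPart (U (x, j)) a) ^ 2)
  linarith [hA, hB]

/-! ## §3 The lattice statement -/

/-- `|P| = 3L³` as a real number is `Fintype.card (Plaquette 3 L)`; we keep the cardinality symbolic. ★ **NEAR THE VACUUM THE WILSON ACTION IS THE
STIFF QUADRATIC FORM**: if `‖U_e − 1‖_F ≤ r ≤ 1` for every link, then `|S(U) − ‖latCurl L (linkVec U)‖²| ≤ 644·|P|·r³`.
[cite: Luscher1983, §3] [cite: MontvayMunster1994, §3.2.3] -/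
theorem abs_wilsonAction_sub_stiff_le (U : GaugeConfig 3 L SU2) {r : ℝ} (hr1 : r ≤ 1)
    (hr : ∀ e, frobNorm ((U e : Matrix (Fin 2) (Fin 2) ℂ) - 1) ≤ r) :
    |wilsonAction su2Rep U - ‖latCurl L (linkVec L U)‖ ^ 2| ≤ 644 * Fintype.card (Plaquette 3 L) * r ^ 3 := by
  rw [wilsonAction_su2_eq_sum, norm_latCurl_linkVec_sq, ← Finset.sum_sub_distrib]
  calc |∑ p : Plaquette 3 L, ((2 - ((su2Rep (plaquetteHolonomy U p.1 p.2.1.1 p.2.1.2)).trace).re) -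
          ∑ a : Fin 3, (vecPart (U (p.1, p.2.1.1)) a + vecPart (U (p.1.shift p.2.1.1, p.2.1.2)) a
            - vecPart (U (p.1.shift p.2.1.2, p.2.1.1)) a - vecPart (U (p.1, p.2.1.2)) a) ^ 2)|
      ≤ ∑ p : Plaquette 3 L, |(2 - ((su2Rep (plaquetteHolonomy U p.1 p.2.1.1 p.2.1.2)).trace).re) -
          ∑ a : Fin 3, (vecPart (U (p.1, p.2.1.1)) a + vecPart (U (p.1.shift p.2.1.1, p.2.1.2)) a
            - vecPart (U (p.1.shift p.2.1.2, p.2.1.1)) a - vecPart (U (p.1, p.2.1.2)) a) ^ 2| := Finset.abs_sum_le_sum_abs _ _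
    _ ≤ ∑ _p : Plaquette 3 L, 644 * r ^ 3 := Finset.sum_le_sum fun p _ => abs_plaquetteTerm_sub_curlVec_sq_le U p.1 _ _ hr1 hr
    _ = 644 * Fintype.card (Plaquette 3 L) * r ^ 3 := by rw [Finset.sum_const, Finset.card_univ, nsmul_eq_mul]; ring

/-- The same with the stiff Hessian: `|S(U) − ⟪v, Hv⟫| ≤ 644·|P|·r³`, `v = linkVec U`, `H = stiffHessian L`. [cite: Luscher1983, §3] -/
theorem abs_wilsonAction_sub_inner_stiffHessian_le (U : GaugeConfig 3 L SU2) {r : ℝ} (hr1 : r ≤ 1)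
    (hr : ∀ e, frobNorm ((U e : Matrix (Fin 2) (Fin 2) ℂ) - 1) ≤ r) :
    |wilsonAction su2Rep U - ⟪linkVec L U, stiffHessian L (linkVec L U)⟫| ≤ 644 * Fintype.card (Plaquette 3 L) * r ^ 3 := by
  rw [inner_stiffHessian]; exact abs_wilsonAction_sub_stiff_le U hr1 hr

end Summit.QuantumFields.YangMills.Theorems.FemtoTransferGap.TwoLattice.Stiff

end
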